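import Summits.QuantumFields.Balaban3D.Carriers.Standard
import Summits.QuantumFields.Balaban3D.Proofs.MassesAC
import Summits.QuantumFields.Balaban3D.Proofs.SeriesAC

/-!
# `Summit.QuantumFields.Balaban3D.Proofs.StandardAC` — print's EXTERNAL INPUTS with the averaging only ABSOLUTELY CONTINUOUS
# (`ExternalInputsAC`: `Ū` with `Carriers.AvgAC` in place of measurability + exact Haar compatibility `Ū_*(dU) = dV`) and THE STANDARD AC
# TOWER INPUT of the lane over them (`stdTowerInputAC`: seat p1's `Carriers.Standard.stdTowerInput` with the UNCAPPED masses
# `MassesAC.massRecAC`) — lane `pub-balaban3d`, seat alpha-1 (definition request `defn-AlphaInputsT3AC` of route `UnitScaleTilt`, cell ym3-torus)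

WHY.  Seat p1's `Carriers.Standard.ExternalInputs` carries the field `av_map : (dU).map Ū = dV` (E6′, [Balaban1985Averaging] (10) p. 19 read
as exact Haar compatibility) — a THEOREM for the lane's axial family `AveragingRT.stdAvg` (`ExternalInputs.ofStd`), but NOT IN PRINT and not in
the tree for the non-linear block averaging `BlockAveraging.blockAvg ℰp` that route `UnitScaleTilt`'s cruxes pin (tree: absolute continuity
`T3UnitLawDensityEML.haarAC_blockAvg` only; exact Haar-ness fails for non-abelian `G`, cell ym-nodeO-ideate P2 reading) — so an (α) package
PINNED to that averaging cannot be typed over `ExternalInputs` (UST owner ruling 2026-08-26, pub/ym3-torus STATUS).  `ExternalInputsAC`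
asks only `AvgAC` (what every construction of seat p1's `Carriers.RT`/`Run` actually consumes), and `stdTowerInputAC X K 𝔖 : TowerInputAC S G`
is the lane's standard tower input over it with the exact-transport masses — every other field (`ε₁ := eps1Of`, `Rcol := rcolOf`, `zcoef :=
zcoefOf`, `rcoef := rcoefOf`, `Rret := rretOf`, block counts `nblkOf`, step parameters `piecesParamsOf`, `Pint`/`E^{(k)}`/barriers from
the series) is seat p1's definition BY NAME.  The lane's own inputs ARE AC inputs (`ExternalInputs.toAC`).  [folklore] bookkeeping;
nothing of [Balaban1985UV3] is asserted.
-/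

open MeasureTheory

namespace Summit.QuantumFields.Balaban3D.Proofs.StandardAC

open Literature.MathematicalPhysics.QuantumFieldTheory.Balaban1983to89
open Literature.MathematicalPhysics.QuantumFieldTheory.Balaban1983to89.TreeLengthTorus (tsys TPt)
open Literature.MathematicalPhysics.QuantumFieldTheory.Balaban1985CMP102
open Literature.MathematicalPhysics.QuantumFieldTheory.Balaban1985CMP102.Setting
open Summit.QuantumFields.Balaban3D.Carriers
open Summit.QuantumFields.Balaban3D.Proofs.TowerAC
open Summit.QuantumFields.Balaban3D.Proofs.SeriesAC
open Summit.QuantumFields.Balaban3D.Proofs.MassesAC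

variable {L : ℕ} {S : Scales L} {G : Type} [GaugeGroup G] [MeasurableSpace G] [HaarData G]

/-! ## §1 External inputs over an absolutely continuous averaging -/

/-- **PRINT'S EXTERNAL INPUTS WITH `Ū` ONLY ABSOLUTELY CONTINUOUS** (twin of seat p1's `Carriers.ExternalInputs`, v1.2, with the pair
`av_meas`/`av_map` replaced by `Carriers.AvgAC`): the averaging `Ū` of [4] per level, measurable with `Ū_*(dU) ≪ dV`; the regular classes and
the minimizers `U_k`, `U_k(·,h)` of [7] Thm 1 / (42) (binder b11). [cite: Balaban1985UV3, (2) p.256 + (42) p.266; Balaban1985Averaging, (10) p.19] -/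
structure ExternalInputsAC {L : ℕ} (S : Scales L) (G : Type) [GaugeGroup G] [MeasurableSpace G] [HaarData G] where
  /-- `Ū` of [4], per level -/
  av : ∀ j, Averaging S.P j G
  /-- `Ū` is measurable and `Ū_*(dU) ≪ dV` (D-1a) -/
  av_ac : ∀ j, AvgAC (av j).avg
  /-- regular classes of [7] -/
  reg : ℕ → Set (GaugeField S.P 0 G)
  /-- minimizers `U_k(V)` of [7] Thm 1, `k ≥ 1` -/
  Uk : (k : ℕ) → GaugeField S.P (k + 1) G → GaugeField S.P 0 G
  /-- composite minimizers `U_k(V, h)` of (42) -/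
  UkH : (k : ℕ) → Hist S.P k → GaugeField S.P k G → GaugeField S.P 0 G
  /-- (42) at the trivial history -/
  UkH_triv : ∀ (k : ℕ) (V : GaugeField S.P k G), UkH k (Hist.triv S.P k) V = ukAll Uk k V

/-- **The lane's (Haar-compatible) external inputs ARE AC inputs** (`ExternalInputs.avgAC`). [folklore] -/
def _root_.Summit.QuantumFields.Balaban3D.Carriers.ExternalInputs.toAC (X : ExternalInputs S G) : ExternalInputsAC S G where
  av := X.av
  av_ac := X.avgAC
  reg := X.reg
  Uk := X.Uk
  UkH := X.UkH
  UkH_triv := X.UkH_triv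

/-- `toAC` keeps the averaging (definitional). [folklore] -/
theorem toAC_av (X : ExternalInputs S G) : X.toAC.av = X.av := rfl

namespace ExternalInputsAC

variable (X : ExternalInputsAC S G)

/-- **THE AXIAL COMPANION** of an AC input record: seat p1's `ExternalInputs.ofStd` over the SAME regular classes and minimizers, with the
averaging replaced by LQB's total axial family `AveragingRT.stdAvg` (measurable and Haar compatible as theorems).  A device for TRANSFERRING
the lane's averaging-independent step leaves (the series leaves about `StepPieces` read neither `Ū` nor the masses) to the AC tower by
definitional equality; never a hypothesis of the AC package. [cite: Balaban1985Averaging, (10) + (15) p.19] -/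
noncomputable def axialCompanion [MeasurableMul₂ G] : ExternalInputs S G :=
  ExternalInputs.ofStd X.reg X.Uk X.UkH X.UkH_triv

/-- The axial companion has the same composite minimizers (definitional). [folklore] -/
theorem axialCompanion_UkH [MeasurableMul₂ G] : (X.axialCompanion).UkH = X.UkH := rfl

/-- The axial companion has the same minimizers (definitional). [folklore] -/
theorem axialCompanion_Uk [MeasurableMul₂ G] : (X.axialCompanion).Uk = X.Uk := rfl

end ExternalInputsAC

/-! ## §2 The uncapped masses as a `HistWeightsAC` and the standard AC tower input -/

section Weights

variable {P : Params} (M₁ : ℕ) (Rcol : ℕ → ℕ) (εL εS : ℕ → ℝ) (av : ∀ j, Averaging P j G)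

/-- **`HistWeightsAC` INHABITED by the exact-transport masses** `MassesAC.massRecAC` (D-p1-5 without the `[0,1]` pin). [cite: Balaban1985UV3, (41) p.266] -/
noncomputable def histWeightsAC : HistWeightsAC P G where
  mass := massRecAC M₁ Rcol εL εS av
  mass_nonneg := massRecAC_nonneg M₁ Rcol εL εS av
  mass_zero := massRecAC_zero M₁ Rcol εL εS av

/-- `histWeightsAC` vanishes on inadmissible histories, pointwise (seat p2's `hW`). [folklore] -/
theorem histWeightsAC_mass_eq_zero_of_not_admissible (k : ℕ) (h : Hist P k) (V : GaugeField P k G)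
    (hh : ¬ Hist.Admissible M₁ Rcol k h) : (histWeightsAC M₁ Rcol εL εS av).mass k h V = 0 :=
  massRecAC_eq_zero_of_not_admissible M₁ Rcol εL εS av k h V hh

end Weights

variable (X : ExternalInputsAC S G) (K : CarrierConsts)

/-- **THE STANDARD AC TOWER BASE** over AC external inputs and constants (seat p1's `ExternalInputs.toTowerBase` with `W := histWeightsAC …`):
`Rcol := rcolOf` (R-COL), `ε₁ := eps1Of`, `zcoef := zcoefOf`, `rcoef := rcoefOf`, `Rret := rretOf` (R-OMEGA), `M₁/b₀/p₀/κ₀ := K.…`.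
[cite: Balaban1985UV3, (38)–(41) p.266] -/
noncomputable def ExternalInputsAC.toTowerBase : TowerBaseAC S G where
  ε₁ := eps1Of S K
  av := X.av
  avgAC := X.av_ac
  reg := X.reg
  Uk := X.Uk
  M₁ := K.M₁
  Rcol := rcolOf S K
  Rret := rretOf S K
  b₀ := K.b₀
  p₀ := K.p₀
  κ₀ := K.κ₀
  W := histWeightsAC K.M₁ (rcolOf S K) (eps1Of S K) (epsSOf S K) X.av
  UkH := X.UkH
  UkH_triv := X.UkH_triv
  zcoef := zcoefOf S K
  rcoef := rcoefOf S K

/-- **THE AC TOWER INPUT over given step parameters**: external inputs, constants, expansion data, parameters `C` — `Pint`, `E^{(k)}` and the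
R-RN barriers DEFINED by `TowerBaseAC.withSeriesAC`. [cite: Balaban1985UV3, (38)–(43) p.266 + (62) p.271] -/
noncomputable def towerInputOfAC {V : Type} [NormedAddCommGroup V] [NormedSpace ℂ V] {Nc : ℕ → ℕ} [∀ k, NeZero (Nc k)]
    (𝔖 : ∀ k, StepSeries S G V (Nc k) k) (C : ∀ k, PiecesParams S k) : TowerInputAC S G :=
  (X.toTowerBase K).withSeriesAC 𝔖 C

section Std

variable {V : Type} [NormedAddCommGroup V] [NormedSpace ℂ V] (𝔖 : ∀ k, StepSeries S G V (nblkOf S K k) k)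

/-- **THE STANDARD AC TOWER INPUT OF THE LANE**: AC external inputs + constants + expansion data; step parameters by `piecesParamsOf`, barriers
by `TowerBaseAC.lowerOfAC`/`upperOfAC`, `Pint`/`E^{(k)}` by the series, block counts by `nblkOf`, chart values in `V` — seat p1's `stdTowerInput`
with uncapped masses and `AvgAC`. [cite: Balaban1985UV3, (38)–(43) p.266 + (55) p.269 + (62) p.271] -/
noncomputable def stdTowerInputAC : TowerInputAC S G :=
  towerInputOfAC X K 𝔖 (piecesParamsOf S K)

/-- `stdTowerInputAC` is `towerInputOfAC` at `piecesParamsOf` (definitional). [folklore] -/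
theorem stdTowerInputAC_eq : stdTowerInputAC X K 𝔖 = towerInputOfAC X K 𝔖 (piecesParamsOf S K) := rfl

/-- The standard AC tower's `M₁` is the constant's (definitional). [folklore] -/
theorem stdTowerInputAC_M₁ : (stdTowerInputAC X K 𝔖).M₁ = K.M₁ := rfl

/-- The standard AC tower's collar profile is `rcolOf` (definitional). [folklore] -/
theorem stdTowerInputAC_Rcol : (stdTowerInputAC X K 𝔖).Rcol = rcolOf S K := rfl

/-- The standard AC tower's averaging is the input's (definitional). [folklore] -/
theorem stdTowerInputAC_av : (stdTowerInputAC X K 𝔖).av = X.av := rfl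

/-- The standard AC tower's masses are the exact transports `massRecAC` (definitional). [folklore] -/
theorem stdTowerInputAC_mass (k : ℕ) (h : Hist S.P k) (U : GaugeField S.P k G) :
    (stdTowerInputAC X K 𝔖).W.mass k h U = massRecAC K.M₁ (rcolOf S K) (eps1Of S K) (epsSOf S K) X.av k h U := rfl

/-- **`hZ` at the standard AC tower — a THEOREM**: `#(blocks ∖ Ω_{k+1}(h)) ≤ |Z_k(h)|` (`SeriesAC.TowerBaseAC.seriesPiecesAC_hZ`). [cite: Balaban1985UV3, p.270 L31] -/
theorem stdTowerInputAC_hZ (k : ℕ) (h : Hist S.P (k + 1)) :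
    (((Finset.univ : Finset (TPt 3 (nblkOf S K k))) \ ΩblkOf K.M₁ (rcolOf S K) (nblkOf S K k) h).card : ℝ) ≤
      ((X.toTowerBase K).seriesPiecesAC 𝔖 (piecesParamsOf S K) k).Zvol h :=
  (X.toTowerBase K).seriesPiecesAC_hZ 𝔖 (piecesParamsOf S K) k h

/-- **The masses of the standard AC tower vanish, POINTWISE, on inadmissible histories** (seat p2's `hW`). [folklore] -/
theorem stdTowerInputAC_mass_eq_zero_of_not_admissible (k : ℕ) (h : Hist S.P k) (U : GaugeField S.P k G)
    (hh : ¬ Hist.Admissible (stdTowerInputAC X K 𝔖).M₁ (stdTowerInputAC X K 𝔖).Rcol k h) :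
    (stdTowerInputAC X K 𝔖).W.mass k h U = 0 :=
  massRecAC_eq_zero_of_not_admissible _ _ _ _ _ k h U hh

/-- **The trivial history has mass `≥ 1`, pointwise** (the floor of `massRecAC`; gives seat p4's `lower57 ≤ upper55`). [folklore] -/
theorem one_le_stdTowerInputAC_mass_triv (k : ℕ) (U : GaugeField S.P k G) :
    1 ≤ (stdTowerInputAC X K 𝔖).W.mass k (Hist.triv S.P k) U :=
  one_le_massRecAC_triv _ _ _ _ _ k U

/-- **The masses of the standard AC tower are measurable.** [folklore] -/
theorem stdTowerInputAC_mass_measurable (k : ℕ) (h : Hist S.P k) : Measurable ((stdTowerInputAC X K 𝔖).W.mass k h) :=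
  measurable_massRecAC _ _ _ _ _ k h

/-- **The masses of the standard AC tower are integrable** (RN transports of integrable densities). [folklore] -/
theorem stdTowerInputAC_mass_integrable [RegularGaugeGroup G] (k : ℕ) (h : Hist S.P k) :
    Integrable ((stdTowerInputAC X K 𝔖).W.mass k h) (fieldMeasure S.P k G) :=
  integrable_massRecAC _ _ _ _ _ k h

/-- The standard AC tower's averaging satisfies `AvgAC` at every level (field of the input). [folklore] -/
theorem stdTowerInputAC_avgAC (j : ℕ) : AvgAC ((stdTowerInputAC X K 𝔖).av j).avg := X.av_ac j

end Std

end Summit.QuantumFields.Balaban3D.Proofs.StandardAC
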